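import Summits.QuantumFields.YangMills.Theorems.UnitScaleTiltHistoryTailZCount

/-!
# Route `UnitScaleTilt` — crux K2-L `HistoryTailL` (stmt-QuantumFields-19936), STUB 4c `stub_diluteExponent`: THE ACTION PARTITION — the corner blocks
# `Δ′(c)` of the large-field plaquettes of an ADMISSIBLE history, grouped by level and by cluster (connected component of any graph in which overlapping
# blocks are adjacent), together with the deep members' boxes inside `Ω_j(h)`, are PAIRWISE DISJOINT sets of fine plaquettes; so for non-negative plaquette
# terms the total action dominates the sum of the localised actions over clusters and deep boxes (support file; the «distinct members force DISTINCT small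
# factors» bookkeeping of the dilute-family exponent bound)

Fleet lead `ym-ust-18916-p1` (gen 3), 2026-08-27.  Inputs: the lane's `AdmissibleRegions.plaqCover_subset_of_admissible` / `scale_eq_of_mem_plaqCover` /
`Omega_antitone` (seat p4), `Run3Collar.tdist_src_le_of_mem_plaqCover` (p2), `HistoryTailLaneTowerReach.tdist_add_le_pow_mul_sdist` (p489534).

* §1 `tdist_toFine_le_of_covers_meet` — two level-`i` plaquettes whose covers share a fine site have representatives `≤ (4 + d)·L^i` apart;
* §2 **`pairwiseDisjoint_clusterBlocks`** (clusters of one level), **`disjoint_levelBlocks`** (different levels), **`disjoint_box_levelBlocks`** (a box inside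
  `Ω_j(h)` against every corner block);
* §3 **`parts_le_total`** — `Σ_{deep b} Σ_{q ∈ Box b} T(q) + Σ_{i<j} Σ_{Γ} Σ_{q ∈ U_{i,Γ}} T(q) ≤ Σ_q T(q)` for `T ≥ 0`, `U_{i,Γ} = ⋃_{c ∈ P_i(h) ∩ Γ} Δ′(c)`.

References: T. Bałaban, CMP 102 (1985) 255–275 [Balaban1985UV3] ((69)–(71) p.273).
-/

noncomputable section

open scoped BigOperators

namespace Summit.QuantumFields.YangMills.Theorems.HistoryTailActionPartition

open Literature.MathematicalPhysics.QuantumFieldTheory.Balaban1983to89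
open B10Eq38TorusDomains (toFine)
open Summit.QuantumFields.Balaban3D.Carriers
open Summit.QuantumFields.Balaban3D.Proofs.AdmissibleRegions (plaqCover_subset_of_admissible scale_eq_of_mem_plaqCover Omega_antitone)
open Summit.QuantumFields.Balaban3D.Proofs.Run3Collar (tdist_src_le_of_mem_plaqCover)
open B3Taylor310LocalRemainder (tdist_comm tdist_triangle)
open Summit.QuantumFields.YangMills.Theorems (coarsen_toFine)
open Summit.QuantumFields.YangMills.Theorems.HistoryTailLaneTowerReach (tdist_add_le_pow_mul_sdist)
open Classical

variable {P : Params}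

/-! ## §1 Overlapping covers have close representatives -/

/-- Two level-`i` plaquettes whose covers share a fine site have representatives at most `(4 + d)·L^i` fine steps apart (standing range). [cite: Balaban1985UV3, (69) p.273] -/
theorem tdist_toFine_le_of_covers_meet {i : ℕ} (hi : i ≤ P.m + P.K) {c c' : Plaq P i} {x : Site P 0} (hx : x ∈ plaqCover c)
    (hx' : x ∈ plaqCover c') : (Site.tdist (toFine i c.src) (toFine i c'.src) : ℝ) ≤ (4 + P.d) * (P.L : ℝ) ^ i := by
  have h1 := tdist_add_le_pow_mul_sdist i hi (toFine i c.src) (toFine i c'.src)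
  have h2 : sdist i (toFine i c.src) (toFine i c'.src) ≤ 4 := by
    unfold sdist
    rw [coarsen_toFine i hi, coarsen_toFine i hi]
    calc Site.tdist c.src c'.src ≤ Site.tdist c.src (coarsen i x) + Site.tdist (coarsen i x) c'.src := tdist_triangle _ _ _
      _ ≤ 2 + 2 := by
          refine Nat.add_le_add (tdist_src_le_of_mem_plaqCover hx) ?_
          rw [tdist_comm]; exact tdist_src_le_of_mem_plaqCover hx'
  have h3 : Site.tdist (toFine i c.src) (toFine i c'.src) ≤ P.L ^ i * 4 + P.d * P.L ^ i := by
    have := Nat.mul_le_mul_left (P.L ^ i) h2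
    omega
  have h4 : (Site.tdist (toFine i c.src) (toFine i c'.src) : ℝ) ≤ ((P.L ^ i * 4 + P.d * P.L ^ i : ℕ) : ℝ) := by exact_mod_cast h3
  refine h4.trans (le_of_eq ?_)
  push_cast; ring

/-! ## §2 Disjointness of the corner blocks across clusters and levels, and of the deep boxes -/

section Disjoint

variable (M₁ : ℕ) (Rcol : ℕ → ℕ) {j : ℕ} (r : Hist P j)
  (Bl : (i : ℕ) → Plaq P i → Finset (Plaq P 0)) (hBl : ∀ i (c : Plaq P i) q, q ∈ Bl i c → q.src ∈ plaqCover c)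

include hBl in
/-- **CLUSTERS OF ONE LEVEL HAVE DISJOINT BLOCKS**: if overlapping covers force adjacency in `G` (`c ≠ c′` in `P_i(h)` with representatives `≤ (4+d)L^i` apart
are adjacent), the unions `U_{i,Γ} = ⋃_{c ∈ P_i ∩ Γ} Δ′(c)` over distinct connected components `Γ` are disjoint. [cite: Balaban1985UV3, (70) p.273] -/
theorem pairwiseDisjoint_clusterBlocks {i : ℕ} (hi : i ≤ P.m + P.K) (hij : i < j) (G : SimpleGraph (Plaq P i))
    (hG : ∀ c ∈ r ⟨i, hij⟩, ∀ c' ∈ r ⟨i, hij⟩, c ≠ c' →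
      (Site.tdist (toFine i c.src) (toFine i c'.src) : ℝ) ≤ (4 + P.d) * (P.L : ℝ) ^ i → G.Adj c c') :
    (((r ⟨i, hij⟩).image G.connectedComponentMk : Finset G.ConnectedComponent) : Set G.ConnectedComponent).PairwiseDisjoint
      fun Γ => ((r ⟨i, hij⟩).filter fun c => G.connectedComponentMk c = Γ).biUnion (Bl i) := by
  intro Γ _ Γ' _ hne
  rw [Function.onFun, Finset.disjoint_left]
  intro q hq hq'
  obtain ⟨c, hc, hqc⟩ := Finset.mem_biUnion.mp hq
  obtain ⟨c', hc', hqc'⟩ := Finset.mem_biUnion.mp hq'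
  obtain ⟨hcP, hcΓ⟩ := Finset.mem_filter.mp hc
  obtain ⟨hc'P, hc'Γ⟩ := Finset.mem_filter.mp hc'
  have hx := hBl i c q hqc
  have hx' := hBl i c' q hqc'
  by_cases hcc : c = c'
  · subst hcc; exact hne (hcΓ.symm.trans hc'Γ)
  · have hadj : G.Adj c c' := hG c hcP c' hc'P hcc (tdist_toFine_le_of_covers_meet hi hx hx')
    have := SimpleGraph.ConnectedComponent.connectedComponentMk_eq_of_adj hadj
    exact hne (hcΓ.symm.trans (this.trans hc'Γ))

include hBl in
/-- **DIFFERENT LEVELS HAVE DISJOINT BLOCKS** (admissible history: the covers of recorded plaquettes of different passages are disjoint,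
`scale_eq_of_mem_plaqCover`). [cite: Balaban1985UV3, p.273] -/
theorem disjoint_levelBlocks (hr : Hist.Admissible M₁ Rcol j r) {i i' : ℕ} (hij : i < j) (hi'j : i' < j) (hne : i ≠ i')
    (A : Finset (Plaq P i)) (hA : A ⊆ r ⟨i, hij⟩) (A' : Finset (Plaq P i')) (hA' : A' ⊆ r ⟨i', hi'j⟩) :
    Disjoint (A.biUnion (Bl i)) (A'.biUnion (Bl i')) := by
  rw [Finset.disjoint_left]
  intro q hq hq'
  obtain ⟨c, hc, hqc⟩ := Finset.mem_biUnion.mp hq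
  obtain ⟨c', hc', hqc'⟩ := Finset.mem_biUnion.mp hq'
  exact hne (scale_eq_of_mem_plaqCover M₁ Rcol hr hij hi'j (hA hc) (hA' hc') (hBl i c q hqc) (hBl i' c' q hqc'))

include hBl in
/-- **A BOX INSIDE `Ω_j(h)` MEETS NO CORNER BLOCK**: the cover of a recorded level-`i` plaquette lies outside `Ω_{i+1}(h) ⊇ Ω_j(h)`. [cite: Balaban1985UV3, p.273] -/
theorem disjoint_box_levelBlocks (hr : Hist.Admissible M₁ Rcol j r) {i : ℕ} (hij : i < j) (A : Finset (Plaq P i)) (hA : A ⊆ r ⟨i, hij⟩)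
    (Box : Finset (Plaq P 0)) (hBox : ∀ q ∈ Box, q.src ∈ Omega M₁ Rcol j r j) : Disjoint Box (A.biUnion (Bl i)) := by
  rw [Finset.disjoint_left]
  intro q hq hq'
  obtain ⟨c, hc, hqc⟩ := Finset.mem_biUnion.mp hq'
  have h1 := (plaqCover_subset_of_admissible M₁ Rcol hr hij (hA hc) (hBl i c q hqc)).2
  exact h1 (Omega_antitone M₁ Rcol j r (i + 1) j hij le_rfl (hBox q hq))

end Disjoint

/-! ## §3 The total action dominates the parts -/

/-- **THE ACTION PARTITION**: for an admissible history `r` of length `j`, graphs `G_i` on the level-`i` plaquettes in which distinct plaquettes of `P_i(r)` with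
representatives `≤ (4+d)L^i` apart are adjacent, corner blocks `Δ′(c)` whose plaquettes have base points in `plaqCover c`, and deep boxes with base points
in `Ω_j(r)`, pairwise disjoint among themselves: for `T ≥ 0`,
`Σ_{b} Σ_{q ∈ Box b} T q + Σ_{i<j} Σ_{Γ ∈ clusters_i} Σ_{q ∈ U_{i,Γ}} T q ≤ Σ_q T q`. [cite: Balaban1985UV3, (5) p.256 and (70)-(71) p.273] -/
theorem parts_le_total (M₁ : ℕ) (Rcol : ℕ → ℕ) {j : ℕ} (hj : j ≤ P.m + P.K) (r : Hist P j) (hr : Hist.Admissible M₁ Rcol j r)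
    (Bl : (i : ℕ) → Plaq P i → Finset (Plaq P 0)) (hBl : ∀ i (c : Plaq P i) q, q ∈ Bl i c → q.src ∈ plaqCover c)
    (G : (i : ℕ) → SimpleGraph (Plaq P i))
    (hG : ∀ i (hij : i < j), ∀ c ∈ r ⟨i, hij⟩, ∀ c' ∈ r ⟨i, hij⟩, c ≠ c' →
      (Site.tdist (toFine i c.src) (toFine i c'.src) : ℝ) ≤ (4 + P.d) * (P.L : ℝ) ^ i → (G i).Adj c c')
    {β : Type*} (Sd : Finset β) (Box : β → Finset (Plaq P 0)) (hBoxΩ : ∀ b ∈ Sd, ∀ q ∈ Box b, q.src ∈ Omega M₁ Rcol j r j)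
    (hBoxDisj : (Sd : Set β).PairwiseDisjoint Box) (T : Plaq P 0 → ℝ) (hT : ∀ q, 0 ≤ T q) :
    ∑ b ∈ Sd, ∑ q ∈ Box b, T q +
      ∑ i ∈ (Finset.range j).attach,
        ∑ Γ ∈ (r ⟨i.1, Finset.mem_range.mp i.2⟩).image (G i.1).connectedComponentMk,
          ∑ q ∈ ((r ⟨i.1, Finset.mem_range.mp i.2⟩).filter fun c => (G i.1).connectedComponentMk c = Γ).biUnion (Bl i.1), T q ≤
      ∑ q, T q := by
  -- the three unions
  set Udeep : Finset (Plaq P 0) := Sd.biUnion Box with hUdeep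
  set Ulev : (i : (Finset.range j : Finset ℕ)) → Finset (Plaq P 0) := fun i => (r ⟨i.1, Finset.mem_range.mp i.2⟩).biUnion (Bl i.1) with hUlev
  set Uclu : Finset (Plaq P 0) := (Finset.range j).attach.biUnion Ulev with hUclu
  -- (1) the deep part
  have hdeep : ∑ b ∈ Sd, ∑ q ∈ Box b, T q = ∑ q ∈ Udeep, T q := by
    rw [hUdeep, Finset.sum_biUnion hBoxDisj]
  -- (2) per level, the clusters partition the level's blocks
  have hlev : ∀ i : (Finset.range j : Finset ℕ),
      ∑ Γ ∈ (r ⟨i.1, Finset.mem_range.mp i.2⟩).image (G i.1).connectedComponentMk,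
          ∑ q ∈ ((r ⟨i.1, Finset.mem_range.mp i.2⟩).filter fun c => (G i.1).connectedComponentMk c = Γ).biUnion (Bl i.1), T q =
        ∑ q ∈ Ulev i, T q := by
    intro i
    have hij : i.1 < j := Finset.mem_range.mp i.2
    rw [← Finset.sum_biUnion (pairwiseDisjoint_clusterBlocks r Bl hBl (by omega) hij (G i.1) (hG i.1 hij))]
    congr 1
    ext q
    simp only [Finset.mem_biUnion, Finset.mem_image, Finset.mem_filter, hUlev]
    constructor
    · rintro ⟨Γ, _, c, ⟨hc, _⟩, hq⟩; exact ⟨c, hc, hq⟩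
    · rintro ⟨c, hc, hq⟩; exact ⟨_, ⟨c, hc, rfl⟩, c, ⟨hc, rfl⟩, hq⟩
  -- (3) the levels are disjoint
  have hlevdisj : ((Finset.range j).attach : Set ((Finset.range j : Finset ℕ))).PairwiseDisjoint Ulev := by
    intro i _ i' _ hne
    have hij : i.1 < j := Finset.mem_range.mp i.2
    have hi'j : i'.1 < j := Finset.mem_range.mp i'.2
    have hne' : i.1 ≠ i'.1 := fun h => hne (Subtype.ext h)
    exact disjoint_levelBlocks M₁ Rcol r Bl hBl hr hij hi'j hne' _ subset_rfl _ subset_rfl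
  have hclu : ∑ i ∈ (Finset.range j).attach, ∑ q ∈ Ulev i, T q = ∑ q ∈ Uclu, T q := by
    rw [hUclu, Finset.sum_biUnion hlevdisj]
  -- (4) deep boxes against all blocks
  have hdc : Disjoint Udeep Uclu := by
    rw [hUdeep, hUclu, Finset.disjoint_biUnion_left]
    intro b hb
    rw [Finset.disjoint_biUnion_right]
    intro i _
    exact disjoint_box_levelBlocks M₁ Rcol r Bl hBl hr (Finset.mem_range.mp i.2) _ subset_rfl (Box b) (hBoxΩ b hb)
  -- (5) assemble
  calc ∑ b ∈ Sd, ∑ q ∈ Box b, T q +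
        ∑ i ∈ (Finset.range j).attach,
          ∑ Γ ∈ (r ⟨i.1, Finset.mem_range.mp i.2⟩).image (G i.1).connectedComponentMk,
            ∑ q ∈ ((r ⟨i.1, Finset.mem_range.mp i.2⟩).filter fun c => (G i.1).connectedComponentMk c = Γ).biUnion (Bl i.1), T q
      = ∑ q ∈ Udeep, T q + ∑ q ∈ Uclu, T q := by rw [hdeep, ← hclu, Finset.sum_congr rfl fun i _ => hlev i]
    _ = ∑ q ∈ Udeep ∪ Uclu, T q := (Finset.sum_union hdc).symm
    _ ≤ ∑ q, T q := Finset.sum_le_univ_sum_of_nonneg fun q => hT q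

end Summit.QuantumFields.YangMills.Theorems.HistoryTailActionPartition

end
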